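import Mathlib.Analysis.SpecialFunctions.Pow.Deriv
import Literature.Analysis.FluidPDE.ElgindiSelfSimilarEquations
import HarnessLib

/-!
# The swirl-free stability theorem of Elgindi–Ghoul–Masmoudi as two named facts: the stability
core (Theorem 2 with its profile) and the compactly supported datum (§2.6)

Topic `Literature/Analysis/FluidPDE`. Companion of `ElgindiSelfSimilarEquations.lean` (the operators
`U`, `V`, `𝓡`, `S_δ`, the elliptic operator, the three systems `Elgindi.IsStreamFunction`,
`Elgindi.IsProfile`, `Elgindi.IsModulatedSolution`, and the rendering of Elgindi's profile — the
amplitude `a`, the `C⁴` clause). Sources: Elgindi–Ghoul–Masmoudi, Camb. J. Math. 9 (2021) =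
arXiv:1910.14071, `[ElgindiGhoulMasmoudi2021]`, §2.5 Thm 2 + §2.6, with the profile of T. M. Elgindi,
Ann. of Math. 194 (2021) = arXiv:1904.04795, `[Elgindi2021]`, §9.5 ("p." = chunk of the held texts).
The swirl-free stability statement "Elgindi's profile + Theorem 2 for it + an admissible compactly
supported datum" is the conjunction of printed statements of very different depth; this file holds
them as **two** named facts and proves the conjunction from them:

* `ElgindiGhoulMasmoudi2021_stabilityCore` — Elgindi's profile `(F, Φ_F, δ)` ([Elgindi2021] §9.5,
  recalled in [ElgindiGhoulMasmoudi2021] §2.3) and **Theorem 2** for it (`k = 4`, `𝒰^φ ≡ 0`): every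
  `C⁴` datum `ε₀` with `|ε₀|_{𝓗⁴} < δ₀α^{3/2}`, `L₁₂(ε₀)(0) = 0` launches a global swirl-free
  modulated solution with `|μ_s| + |λ_s/λ + 1| ≤ C|ε₀|_{𝓗⁴}e^{−κs}` and
  `|W(s) − F|_{𝓗⁰} ≤ C|ε₀|_{𝓗⁴}e^{−κs}`. This is the deep part (coercivity of the linearised
  operator in `𝓗ᵏ`, §3; modulation laws, §5; elliptic estimates, §6; energy estimates and
  bootstrap, §4 and §7; plus the profile construction of [Elgindi2021] §9).
* `ElgindiGhoulMasmoudi2021_compactSupportDatum` — the content of **§2.6** ("Solutions with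
  compactly supported vorticity and finite energy", p. 9): around any `F = aF_* + h` which is `C⁴`
  in the open strip with `|h|_{𝓗⁴} < ∞` there are `C⁴` data `ε₀` of arbitrarily small `𝓗⁴` norm with
  `L₁₂(ε₀)(0) = 0` and `F + ε₀` vanishing for large `z` — an elementary statement about the
  weighted norms of `ElgindiWeightedSpaces.lean` and the operator `L₁₂` of
  `ElgindiFundamentalModel.lean`, independent of any PDE.
* `stabilityNoSwirl_of_core_of_datum` (**proved**): the two together give the bundled statement —
  clauses (i) profile, (ii) Theorem 2, (iii) an admissible datum `ε₀` with `F + ε₀` compactly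
  supported in `z` — with its conclusion spelled out ((iii) is the datum statement at the
  threshold `τ = δ₀α^{3/2}` of clause (ii)). That bundle was formerly vendored as a third named
  fact, `ElgindiGhoulMasmoudi2021_stabilityNoSwirl` (`ElgindiSelfSimilarEquations.lean`); being
  equivalent to the core modulo the elementary datum fact, it has been **merged back** (D-0026
  review: one named fact per printed theorem) and survives only as this theorem.
* `elgindi2021_selfSimilarProfile_of_stabilityCore` (**proved**): the core contains **Elgindi's
  self-similar profile theorem** ([Elgindi2021] §9.5, recalled in [ElgindiGhoulMasmoudi2021] §2.3)
  — clauses (i) — and this projection spells that statement out as its conclusion. The profile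
  statement was formerly vendored as a named fact of its own, `Elgindi2021_selfSimilarProfile`
  (`ElgindiSelfSimilarEquations.lean`); its body being clause (i) of the core verbatim (Theorem 2
  cannot be stated without the profile witnesses `δ, F, Φ_F`, so the profile cannot be factored
  out of the core, only duplicated next to it), it has been **merged back** into the core's proof
  obligation (D-0026 review of a decomposition child: one unproved named fact for the
  Elgindi + Elgindi–Ghoul–Masmoudi self-similar theory, not two overlapping ones) and survives as
  the conclusion of this theorem, with its citation.

Also proved: the explicit profile `F_*` is smooth in the open strip
(`contDiffOn_fundamentalProfile`), which is what makes `h = F − aF_*` as regular as `F` there.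

## The printed §2.6 and the form vendored here

[ElgindiGhoulMasmoudi2021] §2.6, p. 9: "In view of Theorem 2, to get finite-time singularity for
compactly supported solutions, it suffices to show that there exists `ε₀ ∈ 𝓗ᵏ` with small norm so
that `F + ε₀` is compactly supported. … let `χ ∈ C_c^∞([0,∞))` with `χ ≡ 1` on `[0,1]`, `χ ≡ 0` on
`[2,∞)` … `ε₀^{M,β} = (χ(z/M) − 1)F + β sin(2θ)χ((z−3)²)`. Observe that `ε₀ + F` is compactly
supported. Next, observe that `‖ε₀^{M,β}‖_{𝓗ᵏ} ≤ C/M^{1/4} + Cβ + Cα²`. This is just due to the fact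
that `F = F_* + α²g` and `F_* ≈ αz⁻¹` as `z → ∞` and `|g|_{𝓗ᵏ} ≤ C`, while the `𝓗ᵏ` norm is like an
`L²` norm for large `z`. We also use Lemma 9.6 [`|fφ|_{𝓗ᵏ} ≤ C_kC_φ|f|_{𝓗ᵏ}` for radial `φ` with
bounded `D_z^jφ`, the bound independent of `M` for `φ = χ(z/M)`, Remark 9.8]. …
`a_M := L₁₂((χ(z/M) − 1)F)(0)`, `|a_M| ≤ C/M + Cα²` … the fixed constant
`b = L₁₂(sin(2θ)χ((z−3)²))(0) > 0`. Thus we define `β = −a_M/b`. Then `L₁₂(ε^{M,β})(0) = 0` … if we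
take `M = α⁻⁸` and if `α` is sufficiently small, `ε₀^{M,β}` will satisfy the hypothesis of
Theorem 2." The vendored statement is the **qualitative form for fixed `α`**: the same
construction has `‖ε₀^{M,β}‖_{𝓗⁴} → 0` as `M → ∞` (the terms `(χ(z/M) − 1)aF_*` and
`(χ(z/M) − 1)h` are tails of functions with finite `𝓗⁴` functional on `z ≥ 1`, by Lemma 9.6 and
dominated convergence, and `a_M → 0` likewise), so for every threshold `τ > 0` some `ε₀^{M,β}`
has `‖ε₀^{M,β}‖_{𝓗⁴} < τ`. This is exactly how §2.6 is *used* ("will satisfy the hypothesis of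
Theorem 2", whose `δ₀` is produced after `α` is fixed: "for all `α < α₀`, there is a `δ₀ > 0`"),
and it is stated for every `F = aF_* + h`, `h` of finite `𝓗⁴` functional, `F ∈ C⁴` of the open
strip — the only properties of the profile the paragraph uses ("`F = F_* + α²g`",
"`|g|_{𝓗ᵏ} ≤ C`"; the amplitude `a` is the normalisation recorded in clause (i), see
`ElgindiSelfSimilarEquations.lean`). The printed quantitative rate `C/M^{1/4} + Cα²` is not
vendored.

## What is NOT here; the status of the two facts and the size of the core (D-0026 guidance)

No proof of either named fact is in this file. The datum fact is elementary but long (Leibniz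
rules for the iterated slice derivatives `D_z`, `D_θ` on `C⁴` functions of the open strip, the
`𝓗⁴` tail of `F_*`, the integrability of `L₁₂` on `aF_* + 𝓗⁰`, a bump with `L₁₂ > 0`) and **is
discharged** in `ElgindiStabilityDecompositionProofs.lean`
(`ElgindiGhoulMasmoudi2021_compactSupportDatum_holds`, built on the support files
`ElgindiStripCalculus.lean`, `ElgindiHkTools.lean`, `ElgindiCutoffCalculus.lean`,
`ElgindiProfileTail.lean`); so the swirl-free stability statement with its datum
(`stabilityNoSwirl_of_core_of_datum`) rests on the single unproved fact
`ElgindiGhoulMasmoudi2021_stabilityCore`. The core is **one published theorem (with the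
profile it is stated around) and is not to be decomposed into further named facts**
(decompositions do not recurse; an honest `M`-sized restatement of Theorem 2 does not exist).
Its printed proof is the union of [ElgindiGhoulMasmoudi2021] §3 (coercivity of `𝓜_F` in the
inductively defined `𝓗ᵏ` inner products), §5 (the laws of `λ, μ`, Prop. 5.1:
`μ_s/μ = (2+δ)(λ_s/λ + 1)`), §6 (elliptic estimates, Thm 3), §4 and §7 (bootstrap Prop. 4.3,
`dĒ/ds ≤ −cĒ + Cα^{−3/2}Ē^{3/2}`) and [Elgindi2021] §4–§9 (the profile by continuation in `τ`,
§9.5, p. 34), on top of a local well-posedness theory for the modulated system in `𝓗ᵏ` that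
neither source prints. Formally this needs the weighted spaces `𝓗ᵏ` as Hilbert spaces, the
solution operator and estimates of the singular elliptic problem, and a strong-solution theory
for a nonlocal transport system — a theory, not a lemma chain (size XL); Mathlib has none of it.

Mathlib/tree search (`lean search 'stabilityCore|compactSupportDatum|ElgindiGhoulMasmoudi2021_' --decl`):
only the facts of `ElgindiSelfSimilarEquations.lean`, `ElgindiStableBlowupPhysical.lean`,
`ElgindiBlowup*.lean`; nothing of this decomposition exists elsewhere. Used from Mathlib:
`ContDiffOn.rpow_const_of_ne`, `ENNReal.ofReal_ne_top`.
-/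

noncomputable section

open Set Function Real
open scoped ENNReal

namespace Literature.Analysis.FluidPDE

namespace Elgindi

/-! ### Smoothness of the explicit profile in the open strip -/

/-- **`F_*` is smooth in the open quarter strip**: `F_*(z, θ) = (Γ(θ)/c)·4αz/(1+z)²` with
`Γ(θ) = (sin θ cos²θ)^{α/3}`, and on `strip = (0,∞) × (0,π/2)` the base `sin θ cos²θ` is positive
and `1 + z ≠ 0`, so every factor is real-analytic there (any order `n`). [folklore] -/
theorem contDiffOn_fundamentalProfile (α : ℝ) {n : WithTop ℕ∞} :
    ContDiffOn ℝ n (uncurry (fundamentalProfile α)) strip := by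
  have hbase : ContDiffOn ℝ n (fun p : ℝ × ℝ => Real.sin p.2 * Real.cos p.2 ^ 2) strip := by
    fun_prop
  have hΓ : ContDiffOn ℝ n (fun p : ℝ × ℝ => (Real.sin p.2 * Real.cos p.2 ^ 2) ^ (α / 3)) strip := by
    refine hbase.rpow_const_of_ne fun p hp => ?_
    obtain ⟨-, hθ0, hθ1⟩ := hp
    have hs : 0 < Real.sin p.2 := Real.sin_pos_of_pos_of_lt_pi hθ0 (by linarith [pi_pos])
    have hc : 0 < Real.cos p.2 := Real.cos_pos_of_mem_Ioo ⟨by linarith [pi_pos], hθ1⟩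
    positivity
  have hrad : ContDiffOn ℝ n (fun p : ℝ × ℝ => 4 * α * p.1 / (1 + p.1) ^ 2) strip := by
    refine ContDiffOn.div (by fun_prop) (by fun_prop) fun p hp => ?_
    have hz : (0 : ℝ) < p.1 := hp.1
    positivity
  have h := (hΓ.div_const (profileConst α)).mul hrad
  refine h.congr fun p _ => ?_
  simp only [uncurry, fundamentalProfile, angularWeight]

/-- `F − aF_*` is `C⁴` in the open strip as soon as `F` is. [folklore] -/
theorem contDiffOn_sub_smul_fundamentalProfile {α : ℝ} {n : WithTop ℕ∞} {F : ℝ → ℝ → ℝ}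
    (hF : ContDiffOn ℝ n (uncurry F) strip) (a : ℝ) :
    ContDiffOn ℝ n (uncurry (F - a • fundamentalProfile α)) strip := by
  have h := hF.sub ((contDiffOn_fundamentalProfile α (n := n)).const_smul a)
  refine h.congr fun p _ => ?_
  simp [uncurry, smul_eq_mul]

/-! ### The two halves of the fact -/

/-- **The stability core: Elgindi's profile and the swirl-free Theorem 2 of
Elgindi–Ghoul–Masmoudi for it** (the rendering — the systems `Elgindi.IsProfile`,
`Elgindi.IsModulatedSolution`, the norms `Elgindi.eHkNorm`, the amplitude `a` — and the weakenings
are explained in the module docstring of `ElgindiSelfSimilarEquations.lean`). Sources: Camb. J.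
Math. 9 (2021) = arXiv:1910.14071, §2.5 **Theorem 2**, p. 9 of the held text: "For `k ≥ 4`, there
exists `α₀ > 0` small so that for all `α < α₀`, there is a `δ₀ > 0` and `κ > 0` so that for every
initial `(ε₀, 𝒰₀^φ)` with `𝓔(ε₀, 𝒰₀^φ) < δ₀α^{3/2}` and `L₁₂(ε₀)(0) = 0`, there is an associated
unique global solution to [the modulated system (2.x)] so that:
`|μ_s| + |λ_s/λ + 1| + 𝓔(ε, 𝒰^φ)(s) ≤ C𝓔(ε₀, 𝒰₀^φ)e^{−κs}` for all `s ≥ 0`"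
(`𝓔(ε, 0) = ‖ε‖_{𝓗ᵏ}`, Def. 2.1; `W = F + ε`, §2.3, p. 8); the profile: §2.3, p. 7 ("there exists a
self-similar solution `Ω = (T−t)⁻¹F(R/(T−t)^{1+δ}, θ)` … `F = F_* + α²g`, `F_* = (Γ/c)4αz/(1+z)²`,
`|g|_{𝓗ᵏ} ≤ C` with `C` a constant independent of `α`") after Elgindi, Ann. of Math. 194 (2021),
§9.5, p. 34 ("has a unique `𝓗⁴` solution in `B_{Cα²}(0)` and vanishing on `θ = 0` and `θ = π/2`
when `α` is sufficiently small … `μ` and `λ` are of order `α`. This gives a self similar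
solution") and §10, p. 35 (smooth off `θ ∈ {0, π/2}`). **Rendering** (`k = 4`, `𝒰^φ ≡ 0`): there
are `C₀` and `α₀ > 0` such that for every `0 < α < α₀` there are `δ`, a profile `(F, Φ_F)`
(`Elgindi.IsProfile α δ F Φ_F`) with `F ∈ C⁴` of the open strip, continuous up to
`θ ∈ {0, π/2}` and vanishing there, an amplitude `a`, `|a − 1| ≤ C₀α`, with
`|F − aF_*|_{𝓗⁴} ≤ C₀α²`, `L₁₂(F − aF_*)(0) = 0`; and constants `δ₀, κ, C > 0` such that every
`ε₀ ∈ C⁴` of the open strip with `|ε₀|_{𝓗⁴} < δ₀α√α`, `L₁₂(ε₀)(0) = 0` launches a global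
swirl-free modulated solution `(W, Φ_W, λ, μ)` (`Elgindi.IsModulatedSolution`) with
`W(0) = F + ε₀`, `λ(0) = μ(0) = 1`, `|μ_s| + |λ_s/λ + 1| ≤ C|ε₀|_{𝓗⁴}e^{−κs}` (`s > 0`) and
`|W(s) − F|_{𝓗⁰} ≤ C|ε₀|_{𝓗⁴}e^{−κs}` (`s ≥ 0`). Weakenings only: no uniqueness, no swirl,
`k = 4`, `C⁴` data (for which `Elgindi.eHkNorm` is the printed norm), only the `𝓗⁰ ≤ 𝓗⁴` part
of the decay of `𝓔(s)` (the solution is asserted `C¹`, classical in the open strip), the free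
normalisation `λ(0) = μ(0) = 1` (the system only involves `λ_s/λ`, `μ_s/μ`; the printed bound on
`|μ_s|` is for `μ₀ ∈ (1/2, 2)`, Def. 4.1, and `μ_s/μ = (2+δ)(λ_s/λ + 1)`, Prop. 5.1), and
`δ₀, κ, C` depending on `α` as printed while the profile constant `C₀` does not. [cite: ElgindiGhoulMasmoudi2021, §2.5 Def 2.1 and Thm 2 (p. 9 of arXiv:1910.14071); §2.3 (p. 7–8); Def 4.1 (p. 12), Prop 5.1 (p. 13)]
[cite: Elgindi2021, §9.5 (p. 34 of arXiv:1904.04795) and §10 (p. 35): the profile and its interior smoothness] -/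
def ElgindiGhoulMasmoudi2021_stabilityCore : Prop :=
  ∃ C₀ α₀ : ℝ, 0 < α₀ ∧ ∀ α : ℝ, 0 < α → α < α₀ →
    ∃ (δ : ℝ) (F ΦF : ℝ → ℝ → ℝ),
      -- (i) the profile (Elgindi 2021, recalled in §2.3)
      IsProfile α δ F ΦF ∧
      ContDiffOn ℝ 4 (uncurry F) strip ∧
      ContinuousOn (uncurry F) (Set.Ioi 0 ×ˢ Set.Icc 0 (π / 2)) ∧
      (∀ z, 0 < z → F z 0 = 0 ∧ F z (π / 2) = 0) ∧
      (∃ a : ℝ, |a - 1| ≤ C₀ * α ∧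
        eHkNorm α 4 (F - a • fundamentalProfile α) ≤ ENNReal.ofReal (C₀ * α ^ 2) ∧
        L12 (F - a • fundamentalProfile α) 0 = 0) ∧
      ∃ δ₀ κ C : ℝ, 0 < δ₀ ∧ 0 < κ ∧ 0 < C ∧
        -- (ii) Theorem 2, swirl-free, k = 4
        (∀ ε₀ : ℝ → ℝ → ℝ, ContDiffOn ℝ 4 (uncurry ε₀) strip →
          eHkNorm α 4 ε₀ < ENNReal.ofReal (δ₀ * (α * Real.sqrt α)) → L12 ε₀ 0 = 0 →
          ∃ (W Φ : ℝ → ℝ → ℝ → ℝ) (lam mu : ℝ → ℝ),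
            IsModulatedSolution α δ W Φ lam mu ∧ W 0 = F + ε₀ ∧ lam 0 = 1 ∧ mu 0 = 1 ∧
            (∀ s, 0 < s → |deriv mu s| + |deriv lam s / lam s + 1| ≤
              C * (eHkNorm α 4 ε₀).toReal * Real.exp (-κ * s)) ∧
            (∀ s, 0 ≤ s → eHkNorm α 0 (W s - F) ≤
              ENNReal.ofReal (C * (eHkNorm α 4 ε₀).toReal * Real.exp (-κ * s))))

/-- **The compactly supported datum of Elgindi–Ghoul–Masmoudi §2.6** (Camb. J. Math. 9 (2021) =
arXiv:1910.14071, §2.6, p. 9 of the held text: "it suffices to show that there exists `ε₀ ∈ 𝓗ᵏ`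
with small norm so that `F + ε₀` is compactly supported … `ε₀^{M,β} = (χ(z/M) − 1)F +
β sin(2θ)χ((z−3)²)`. Observe that `ε₀ + F` is compactly supported … `‖ε₀^{M,β}‖_{𝓗ᵏ} ≤ C/M^{1/4} +
Cβ + Cα²`. This is just due to the fact that `F = F_* + α²g` and `F_* ≈ αz⁻¹` as `z → ∞` and
`|g|_{𝓗ᵏ} ≤ C`, while the `𝓗ᵏ` norm is like an `L²` norm for large `z`. We also use Lemma 9.6. …
`β = −a_M/b` [`a_M = L₁₂((χ(z/M) − 1)F)(0)`, `b = L₁₂(sin(2θ)χ((z−3)²))(0) > 0`]. Then we have: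
`L₁₂(ε^{M,β})(0) = 0` … `ε₀^{M,β}` will satisfy the hypothesis of Theorem 2"; Lemma 9.6 with
Remark 9.8, p. 20: `|fφ|_{𝓗ᵏ} ≤ C_kC_φ|f|_{𝓗ᵏ}` for radial `φ ∈ Cᵏ` with bounded `D_z^jφ`,
uniformly in `M` for `φ = χ(z/M)`). **Rendering (qualitative form for fixed `α`, see the module
docstring).** For every `α > 0`, every amplitude `a` and every `F` which is `C⁴` in the open
quarter strip with `|F − aF_*|_{𝓗⁴} < ∞` (`Elgindi.eHkNorm α 4`, `F_* = Elgindi.fundamentalProfile α`),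
and every threshold `τ > 0`, there is a datum `ε₀`, `C⁴` in the open strip, with `|ε₀|_{𝓗⁴} < τ`,
`L₁₂(ε₀)(0) = 0` (`Elgindi.L12`), and `F + ε₀` vanishing identically for `z ≥ M` for some `M`
(all `θ ∈ [0, π/2]`). The printed rate `C/M^{1/4} + Cα²` and the specific shape of `ε₀` are not
part of the statement; arbitrary smallness for fixed `α` is what the construction gives as
`M → ∞` (tails of functions with finite `𝓗⁴` functional on `z ≥ 1`, `a_M → 0`) and what the
sentence "will satisfy the hypothesis of Theorem 2" uses. [cite: ElgindiGhoulMasmoudi2021, §2.6 (p. 9 of arXiv:1910.14071); Lemma 9.6 and Remark 9.8 (p. 20)] -/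
def ElgindiGhoulMasmoudi2021_compactSupportDatum : Prop :=
  ∀ α : ℝ, 0 < α → ∀ (a : ℝ) (F : ℝ → ℝ → ℝ), ContDiffOn ℝ 4 (uncurry F) strip →
    eHkNorm α 4 (F - a • fundamentalProfile α) ≠ ∞ →
    ∀ τ : ℝ, 0 < τ →
      ∃ ε₀ : ℝ → ℝ → ℝ, ContDiffOn ℝ 4 (uncurry ε₀) strip ∧
        eHkNorm α 4 ε₀ < ENNReal.ofReal τ ∧ L12 ε₀ 0 = 0 ∧
        ∃ M : ℝ, ∀ z θ, M ≤ z → θ ∈ Set.Icc 0 (π / 2) → F z θ + ε₀ z θ = 0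

/-! ### The glue (proved) -/

/-- **Elgindi's self-similar blow-up profile, as contained in the stability core** (projection on
clauses (i)). The conclusion is, verbatim, the statement formerly vendored as the named fact
`Elgindi2021_selfSimilarProfile` (merged back into the core, see the module docstring): T. M.
Elgindi, *Finite-time singularity formation for `C^{1,α}` solutions to the incompressible Euler
equations on `ℝ³`*, Ann. of Math. 194 (2021), §9 (p. 30 of the held text of arXiv:1904.04795: the
ansatz `Ω = (1−(1+μ)t)⁻¹F(R/(1−(1+μ)t)^{1+λ}, θ)` for the dilated equation `½∂ₜΩ + … = 𝓡(Ψ)Ω`,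
`F = F_* + g`, `F_* = α(Γ/c)2z/(1+z)²`, "`μ` and `λ` will be chosen to ensure that there exists a
(small) `g ∈ 𝓗²` with `L₁₂(g)(0) = 0` so that `F = F_* + g` solves the above") and §9.5 (p. 34:
the `g` equation "has a unique `𝓗⁴` solution in `B_{Cα²}(0)` and vanishing on `θ = 0` and
`θ = π/2` when `α` is sufficiently small. From there we also see that `μ` and `λ` are of order `α`.
This gives a self similar solution … and, in particular, implies Theorem 1"); recalled by
Elgindi–Ghoul–Masmoudi, Camb. J. Math. 9 (2021), §2.3, p. 7: "there exists a self-similar solution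
of the form `Ω = (T−t)⁻¹F(R/(T−t)^{1+δ}, θ)` where `δ` is a small real number depending on `α`.
Recall that `F = F_* + α²g`, where `F_* = (Γ/c)4αz/(1+z)²`, `|g|_{𝓗ᵏ} ≤ C`, with `C` a constant
independent of `α`". **Rendering** (as in clause (i) of the core; the module docstring of
`ElgindiSelfSimilarEquations.lean` explains it): there are `C` and `α₀ > 0` such that for every
`0 < α < α₀` there are `δ ∈ ℝ` and `(F, Φ_F)` solving the profile system classically in the open
quarter strip (`Elgindi.IsProfile`), `F` of class `C⁴` there and continuous up to `θ ∈ {0, π/2}`,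
where it vanishes, and an amplitude `a` with `|a − 1| ≤ Cα`, `|F − aF_*|_{𝓗⁴} ≤ Cα²`,
`L₁₂(F − aF_*)(0) = 0` (`a = (1+μ)⁻¹` records the normalisation: Elgindi's dilated ansatz becomes
the profile system for `2F/(1+μ) = (1+μ)⁻¹F_* + 2g/(1+μ)`, and `F_* ∉ 𝓗⁰`, so `a = 1` is not
asserted). Not vendored: uniqueness, the size of `δ`, Elgindi's Theorem 1 itself. [cite: Elgindi2021, §9 (p. 30) and §9.5 (p. 34 of arXiv:1904.04795); §10 (p. 35)]
[cite: ElgindiGhoulMasmoudi2021, §2.3 (p. 7 of arXiv:1910.14071): the recalled profile F = F_* + α²g] -/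
theorem elgindi2021_selfSimilarProfile_of_stabilityCore (h : ElgindiGhoulMasmoudi2021_stabilityCore) :
    ∃ C α₀ : ℝ, 0 < α₀ ∧ ∀ α : ℝ, 0 < α → α < α₀ →
      ∃ (δ : ℝ) (F Φ : ℝ → ℝ → ℝ), IsProfile α δ F Φ ∧
        ContDiffOn ℝ 4 (uncurry F) strip ∧
        ContinuousOn (uncurry F) (Set.Ioi 0 ×ˢ Set.Icc 0 (π / 2)) ∧
        (∀ z, 0 < z → F z 0 = 0 ∧ F z (π / 2) = 0) ∧
        ∃ a : ℝ, |a - 1| ≤ C * α ∧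
          eHkNorm α 4 (F - a • fundamentalProfile α) ≤ ENNReal.ofReal (C * α ^ 2) ∧
          L12 (F - a • fundamentalProfile α) 0 = 0 := by
  obtain ⟨C₀, α₀, hα₀, H⟩ := h
  refine ⟨C₀, α₀, hα₀, fun α hα hαα₀ => ?_⟩
  obtain ⟨δ, F, ΦF, hP, h4, hc, hbc, ha, -⟩ := H α hα hαα₀
  exact ⟨δ, F, ΦF, hP, h4, hc, hbc, ha⟩

/-- **Assembly: the swirl-free stability statement with the compactly supported datum** —
(i) Elgindi's profile, (ii) Theorem 2 of Elgindi–Ghoul–Masmoudi for it (`k = 4`, `𝒰^φ ≡ 0`), and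
(iii) an admissible datum `ε₀` (`C⁴`, `|ε₀|_{𝓗⁴} < δ₀α√α`, `L₁₂(ε₀)(0) = 0`) with `F + ε₀` vanishing
for `z ≥ M` — from the stability core and the §2.6 datum fact: clause (iii) is the datum statement
for the profile `F = aF_* + (F − aF_*)` of clause (i) (`|F − aF_*|_{𝓗⁴} ≤ C₀α² < ∞`, `F ∈ C⁴` of the
open strip) at the threshold `τ = δ₀α√α > 0` of clause (ii) (Elgindi–Ghoul–Masmoudi 2021, §2.6:
"if `α` is sufficiently small, `ε₀^{M,β}` will satisfy the hypothesis of Theorem 2"). The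
conclusion is, verbatim, the statement formerly vendored as the named fact
`ElgindiGhoulMasmoudi2021_stabilityNoSwirl` (merged back, see the module docstring). [cite: ElgindiGhoulMasmoudi2021, §2.5 Thm 2 and §2.6 (p. 9 of arXiv:1910.14071)] -/
theorem stabilityNoSwirl_of_core_of_datum (h₁ : ElgindiGhoulMasmoudi2021_stabilityCore)
    (h₂ : ElgindiGhoulMasmoudi2021_compactSupportDatum) :
    ∃ C₀ α₀ : ℝ, 0 < α₀ ∧ ∀ α : ℝ, 0 < α → α < α₀ →
      ∃ (δ : ℝ) (F ΦF : ℝ → ℝ → ℝ),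
        -- (i) the profile (Elgindi 2021, recalled in §2.3)
        IsProfile α δ F ΦF ∧
        ContDiffOn ℝ 4 (uncurry F) strip ∧
        ContinuousOn (uncurry F) (Set.Ioi 0 ×ˢ Set.Icc 0 (π / 2)) ∧
        (∀ z, 0 < z → F z 0 = 0 ∧ F z (π / 2) = 0) ∧
        (∃ a : ℝ, |a - 1| ≤ C₀ * α ∧
          eHkNorm α 4 (F - a • fundamentalProfile α) ≤ ENNReal.ofReal (C₀ * α ^ 2) ∧
          L12 (F - a • fundamentalProfile α) 0 = 0) ∧
        ∃ δ₀ κ C : ℝ, 0 < δ₀ ∧ 0 < κ ∧ 0 < C ∧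
          -- (ii) Theorem 2, swirl-free, k = 4
          (∀ ε₀ : ℝ → ℝ → ℝ, ContDiffOn ℝ 4 (uncurry ε₀) strip →
            eHkNorm α 4 ε₀ < ENNReal.ofReal (δ₀ * (α * Real.sqrt α)) → L12 ε₀ 0 = 0 →
            ∃ (W Φ : ℝ → ℝ → ℝ → ℝ) (lam mu : ℝ → ℝ),
              IsModulatedSolution α δ W Φ lam mu ∧ W 0 = F + ε₀ ∧ lam 0 = 1 ∧ mu 0 = 1 ∧
              (∀ s, 0 < s → |deriv mu s| + |deriv lam s / lam s + 1| ≤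
                C * (eHkNorm α 4 ε₀).toReal * Real.exp (-κ * s)) ∧
              (∀ s, 0 ≤ s → eHkNorm α 0 (W s - F) ≤
                ENNReal.ofReal (C * (eHkNorm α 4 ε₀).toReal * Real.exp (-κ * s)))) ∧
          -- (iii) §2.6: an admissible datum with `F + ε₀` compactly supported in `z`
          (∃ ε₀ : ℝ → ℝ → ℝ, ContDiffOn ℝ 4 (uncurry ε₀) strip ∧
            eHkNorm α 4 ε₀ < ENNReal.ofReal (δ₀ * (α * Real.sqrt α)) ∧ L12 ε₀ 0 = 0 ∧
            ∃ M : ℝ, ∀ z θ, M ≤ z → θ ∈ Set.Icc 0 (π / 2) → F z θ + ε₀ z θ = 0) := by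
  obtain ⟨C₀, α₀, hα₀, H⟩ := h₁
  refine ⟨C₀, α₀, hα₀, fun α hα hαα₀ => ?_⟩
  obtain ⟨δ, F, ΦF, hP, h4, hc, hbc, ⟨a, ha, hFa, hL⟩, δ₀, κ, C, hδ₀, hκ, hC, hii⟩ := H α hα hαα₀
  have hfin : eHkNorm α 4 (F - a • fundamentalProfile α) ≠ ∞ :=
    ne_top_of_le_ne_top ENNReal.ofReal_ne_top hFa
  have hτ : 0 < δ₀ * (α * Real.sqrt α) := mul_pos hδ₀ (mul_pos hα (Real.sqrt_pos.2 hα))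
  obtain ⟨ε₀, hε4, hεn, hεL, M, hM⟩ := h₂ α hα a F h4 hfin _ hτ
  exact ⟨δ, F, ΦF, hP, h4, hc, hbc, ⟨a, ha, hFa, hL⟩, δ₀, κ, C, hδ₀, hκ, hC, hii,
    ε₀, hε4, hεn, hεL, M, hM⟩

/-- The datum fact also feeds the profile's consumers directly: under it, every profile as in
clause (i) of the core (`elgindi2021_selfSimilarProfile_of_stabilityCore`) admits admissible
compactly supported perturbations of any prescribed `𝓗⁴`-size. [folklore] -/
theorem exists_compactSupportDatum_of_profile (h₂ : ElgindiGhoulMasmoudi2021_compactSupportDatum)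
    {α C₀ a : ℝ} (hα : 0 < α) {F : ℝ → ℝ → ℝ} (hF : ContDiffOn ℝ 4 (uncurry F) strip)
    (hFa : eHkNorm α 4 (F - a • fundamentalProfile α) ≤ ENNReal.ofReal (C₀ * α ^ 2))
    {τ : ℝ} (hτ : 0 < τ) :
    ∃ ε₀ : ℝ → ℝ → ℝ, ContDiffOn ℝ 4 (uncurry ε₀) strip ∧
      eHkNorm α 4 ε₀ < ENNReal.ofReal τ ∧ L12 ε₀ 0 = 0 ∧
      ∃ M : ℝ, ∀ z θ, M ≤ z → θ ∈ Set.Icc 0 (π / 2) → F z θ + ε₀ z θ = 0 :=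
  h₂ α hα a F hF (ne_top_of_le_ne_top ENNReal.ofReal_ne_top hFa) τ hτ

end Elgindi

end Literature.Analysis.FluidPDE
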